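import Mathlib
import Summits.Ventures.PercRepro2.LeafRowCutOneFar
import Summits.Ventures.PercRepro2.LeafRowCoincidences

/-!
# `b` or `o` alone behind a cut vertex that is another mark: row (LEAF-½) outright
(blind cell PercRepro2, p5 g28; `proofs/P5-OEDGE.md` §38)

`LeafRowCutOneFar.lean` reduces the row for a non-root mark alone behind a cut vertex `z` to the
row on the reduced pendant graph with the mark moved to `z`; when `z` is itself one of the other
marks, that reduced row is a coincidence row — `LeafRowCoincidences.lean` for `b`, `o` at a root or
at each other, `LeafAA0Reductions.lean` for `v` at `b`, `o` — so the row on `G` is unconditional: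

* **`LeafRow_b_behind_mark`**: `b` alone behind a cut vertex `z ∈ {a₂, a₁, o, v}`;
* **`LeafRow_o_behind_mark`**: `o` alone behind a cut vertex `z ∈ {a₂, a₁, b, v}`

(`LeafRow_v_behind_mark` is in `LeafRowCutOneFar.lean`). The left side is arbitrary. Nothing here
claims the row in general.
-/

namespace Summit.Ventures.PercRepro2

open CovForm CutVertexM9 CutOneFar LeafStep UnionCluster PendantRoot PendantO LeafHalfCross
  LeafRowCutOneFar LeafRowCoincidences

namespace LeafRowBehindMark

variable {V : Type*} {E : Type*} [Fintype E] [DecidableEq E] [Fintype V] [DecidableEq V]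
  {R : Type*} [Field R] [LinearOrder R] [IsStrictOrderedRing R]
variable {ends : E → Sym2 V} {side : E → Bool} {L : Set V} {z : V} {Rt : Set V}

/-- **`b` alone behind a cut vertex that is a MARK**: the row holds outright when the cut vertex is
`a₂`, `a₁`, `o` or `v`. -/
theorem LeafRow_b_behind_mark (h : CutVertex ends side L z Rt) {p : E → R} (hp : IsProbVec p)
    {o a₁ a₂ v b : V} (hb : b ∈ L) (ho : o ∈ Rt ∨ o = z) (h1 : a₁ ∈ Rt ∨ a₁ = z)
    (h2 : a₂ ∈ Rt ∨ a₂ = z) (hv : v ∈ Rt ∨ v = z) (hz : z = a₂ ∨ z = a₁ ∨ z = o ∨ z = v) :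
    LeafRow p ends o a₁ a₂ v b := by
  refine LeafRow_b_behind_cut h hp hb ho h1 h2 hv ?_
  have hp' := isProbVec_rweights_leftProb ends side z b hp
  rcases hz with rfl | rfl | rfl | rfl
  · exact LeafRow_b_root _ _ hp' o a₁ z v
  · exact LeafRow_b_root' _ _ hp' o z a₂ v
  · exact LeafRow_b_eq_o _ _ hp' a₁ a₂ v z
  · exact LeafRow_of_AA0 _ _ hp' o a₁ a₂ z z (crossAA_mark_b_nonneg _ _ hp' o a₁ a₂ z)

/-- **`o` alone behind a cut vertex that is a MARK**: the row holds outright when the cut vertex is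
`a₂`, `a₁`, `b` or `v`. -/
theorem LeafRow_o_behind_mark (h : CutVertex ends side L z Rt) {p : E → R} (hp : IsProbVec p)
    {o a₁ a₂ v b : V} (ho : o ∈ L) (h1 : a₁ ∈ Rt ∨ a₁ = z) (h2 : a₂ ∈ Rt ∨ a₂ = z)
    (hv : v ∈ Rt ∨ v = z) (hb : b ∈ Rt ∨ b = z) (hz : z = a₂ ∨ z = a₁ ∨ z = b ∨ z = v) :
    LeafRow p ends o a₁ a₂ v b := by
  refine LeafRow_o_behind_cut h hp ho h1 h2 hv hb ?_
  have hp' := isProbVec_rweights_leftProb ends side z o hp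
  rcases hz with rfl | rfl | rfl | rfl
  · exact LeafRow_o_root _ _ hp' a₁ z v b
  · exact LeafRow_o_root' _ _ hp' z a₂ v b
  · exact LeafRow_b_eq_o _ _ hp' a₁ a₂ v z
  · exact LeafRow_of_AA0 _ _ hp' z a₁ a₂ z b (crossAA_mark_o_nonneg _ _ hp' z a₁ a₂ b)

end LeafRowBehindMark

end Summit.Ventures.PercRepro2
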